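import Literature.NumberTheory.Automorphic.U3LocalBruhatDecompositionProofs   -- ★ `UnitaryGroup.qsInvolution` (`Θ_σ g = w⁰ ᵗ(σg)⁻¹ w⁰`), `coe_qsInvolution`, `antidiagonal_over_eq_coe_weylLong`
import Literature.NumberTheory.Automorphic.UnitaryLatticeTreeApartment         -- ★ `mem_mapGL_iff`, `dualLatt_mapGL` (the unitary case of W9-a)
import Literature.NumberTheory.Automorphic.UnitaryLatticeTreeTypeTwoChild      -- ★ `isIntMatrix_antidiagonal`, `isIntMatrix_antidiagonal_inv` (+ ★ `UnitaryLatticeTreeTypes`: `dualLatt_dualLatt_latt`, `dualLatt_stdLattice_eq_self`)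
import Literature.NumberTheory.Automorphic.UnitaryLatticeTreeDual              -- ★ `pairing_mulVec_left`, `pairing_mulVec_right` (change of basis in the pairing)
import HarnessLib

/-!
# R90 · S6 «Ch. 14.1–14.5 stable trace formula» — WAVE 9 cards W9-a, W9-b, W9-d, W9-e₁: THE TWISTED POLARITY `P_δ : Λ ↦ δ·Λ^♯`
# (`Theorems/R90S6TwistedPolarity.lean`, API module)

DAG r5 row E1.4.3.1.2 «TWISTED POLARITY `P_δ : Λ ↦ δ·(Λ)^♯`» (W9 sheet `R90/R90-C14-typ2/g2/S6_wave9_targets.v1.fcf093c820d92b07.lean`,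
targets :65 W9-a, :74 W9-b, :104 W9-d, :114 W9-e₁ VERBATIM; ns without `.Wave9`).  `K` a valued field (`Valued K ℤᵐ⁰`), `σ : K →+* K`,
`𝒪 = 𝒪[K]`, `J₀ = w⁰ = (StdForm.antidiagonal N).over K` (★ `antidiagonal_over_eq_coe_weylLong`), `Θ = Θ_σ = UnitaryGroup.qsInvolution σ`
(`Θ g = w⁰ · ᵗ(σ g)⁻¹ · w⁰`, so `U(σ, J₀) = Fix Θ`), `Λ^♯ = dualLatt σ J₀ Λ = {x : ∀ y ∈ Λ, v (ᵗ(σ y) J₀ x) ≤ 1}`, `g·Λ = mapGL g Λ`: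

* W9-a `dualLatt_mapGL_eq_mapGL_qsInvolution` — `(γ·M)^♯ = Θ(γ)·M^♯` for EVERY `γ ∈ GL_N(K)` and every `𝒪`-submodule `M`, no hypothesis on `σ`
  (key matrix identity `ᵗ(σγ) · J₀ · Θ(γ) = J₀`, i.e. `⟨γ y, Θ(γ) x⟩ = ⟨y, x⟩`; the unitary case `Θ u = u` is ★ `dualLatt_mapGL`);
* W9-b `mapGL_qsInvolution_stdLattice` — `Θ(γ)·𝒪^N = (γ·𝒪^N)^♯` (W9-a at `M = 𝒪^N` + ★ `dualLatt_stdLattice_eq_self`: `𝒪^N` is `J₀`-self-dual);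
* W9-d `mapGL_dualLatt_mapGL_dualLatt_latt` — `P_δ (P_δ Λ) = (δ Θ(δ))·Λ` on full-rank lattices for an involution `σ` preserving `v`
  (W9-a, then ★ `dualLatt_dualLatt_latt`: `Λ^♯♯ = Λ` for the hermitian unimodular `J₀`);
* W9-e₁ `mapGL_dualLatt_eq_dualLatt_mul_inv` — `δ·M^{♯,H} = M^{♯, H δ⁻¹}` for every form matrix `H` (pure algebra, ★ `pairing_mulVec_right`).

Cell `hodgecm-mathlib`, crux H413 (`stmt-HodgeConjecture-24833`), route of record `HCCMUnconditional`; programme R90-TF (brief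
`director/R90-BRIEF.v2.md` 1f40d54518340a35), section S6 (base `R90-C14`, dealer R90-C14-plan (g2)), seat R90-C14-p03 (g2); W9 RE-CUT BY NAME
2026-09-04T23:48:46Z («p03 (g2) TAKES W9-a + W9-b + W9-d + W9-e₁ … ONE API-module file `Theorems/R90S6TwistedPolarity.lean`, house-rule (2)
exception»).  Lane `--kind proof --supports stmt-HodgeConjecture-24833 --as helper`; THEOREMS ONLY over ★ Literature carriers (no definition, no
instance, no notation, no named fact, no kit, no `sorry`); W9-c (p10) imports this module.
HONEST LABEL: lattice bookkeeping, count-neutral until the E1.4.3.3.x ∕ E1.3.9 assemblies consume it; proves no printed global statement,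
discharges no citation; HC_CM is proved only modulo the 7 printed citations (2 remaining named inputs: hLiu418 = stmt-HodgeConjecture-24832,
h413 = stmt-HodgeConjecture-24833) until rung 0 closes.

## References
* [Rogawski1990] J. D. Rogawski, *Automorphic Representations of Unitary Groups in Three Variables*, Ann. of Math. Stud. 123 (1990), §1.9–§1.10 pp. 8–9 (`Θ`, `w⁰`, `U = GL_N^{Θσ}`).
* [ShimuraIATAF1971] G. Shimura, *Introduction to the Arithmetic Theory of Automorphic Functions* (1971), §3.1–§3.3 (lattices, duals, elementary divisors).
* [Jacobowitz1962] R. Jacobowitz, *Hermitian forms over local fields*, Amer. J. Math. 84 (1962), §4 (dual lattices).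
* [Kottwitz1986BaseChangeUnits] R. Kottwitz, *Base change for unit elements of Hecke algebras*, Compositio Math. 60 (1986), §1 pp. 239–242 (`X_L`, the norm `N δ`).
-/

set_option autoImplicit false
-- the mandated namespace repeats the single-problem summit's segment (`HodgeConjecture.HodgeConjecture`)
set_option linter.dupNamespace false

noncomputable section

open scoped Valued WithZero Matrix MatrixGroups
open Literature.NumberTheory.Automorphic Literature.NumberTheory.Automorphic.HermitianLattice
  Literature.NumberTheory.Automorphic.UnitaryLatticeTree Literature.NumberTheory.Automorphic.CartanUnique

namespace Summit.HodgeConjecture.HodgeConjecture.R90.S6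

variable {K : Type*} [Field K] [Valued K ℤᵐ⁰] {σ : K →+* K} {N : ℕ}

/-! ## The key matrix identity `ᵗ(σγ) · J₀ · Θ_σ(γ) = J₀` and its pairing form -/

omit [Valued K ℤᵐ⁰] in
/-- **`ᵗ(σγ) · w⁰ · Θ_σ(γ) = w⁰`** for every `γ ∈ GL_N(K)`: with `Θ_σ(γ) = w⁰ ᵗ(σγ)⁻¹ w⁰` and `(w⁰)² = 1` this is
`ᵗ(σγ) · ᵗ(σγ)⁻¹ · w⁰ = w⁰`. [cite: Rogawski1990, §1.9 p. 8] -/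
theorem transpose_map_mul_antidiagonal_mul_qsInvolution (γ : GL (Fin N) K) :
    ((γ : Matrix (Fin N) (Fin N) K).map σ)ᵀ * (StdForm.antidiagonal N).over K *
        ((UnitaryGroup.qsInvolution σ γ : GL (Fin N) K) : Matrix (Fin N) (Fin N) K) = (StdForm.antidiagonal N).over K := by
  -- `σγ` is invertible (it is the matrix of the unit `GL.map σ γ`)
  have hdet : IsUnit ((γ : Matrix (Fin N) (Fin N) K).map σ).det :=
    Matrix.isUnits_det_units (Matrix.GeneralLinearGroup.map σ γ)
  have hw : ((weylLong N K : GL (Fin N) K) : Matrix (Fin N) (Fin N) K) * ((weylLong N K : GL (Fin N) K) : Matrix (Fin N) (Fin N) K) = 1 := by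
    rw [← Units.val_mul, weylLong_mul_self, Units.val_one]
  rw [UnitaryGroup.coe_qsInvolution, UnitaryGroup.antidiagonal_over_eq_coe_weylLong]
  calc ((γ : Matrix (Fin N) (Fin N) K).map σ)ᵀ * ((weylLong N K : GL (Fin N) K) : Matrix (Fin N) (Fin N) K) *
        (((weylLong N K : GL (Fin N) K) : Matrix (Fin N) (Fin N) K) * ((((γ : Matrix (Fin N) (Fin N) K)).map σ)⁻¹)ᵀ *
          ((weylLong N K : GL (Fin N) K) : Matrix (Fin N) (Fin N) K))
        = ((γ : Matrix (Fin N) (Fin N) K).map σ)ᵀ *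
            (((weylLong N K : GL (Fin N) K) : Matrix (Fin N) (Fin N) K) * ((weylLong N K : GL (Fin N) K) : Matrix (Fin N) (Fin N) K)) *
            ((((γ : Matrix (Fin N) (Fin N) K)).map σ)⁻¹)ᵀ * ((weylLong N K : GL (Fin N) K) : Matrix (Fin N) (Fin N) K) := by
          simp only [Matrix.mul_assoc]
    _ = ((((γ : Matrix (Fin N) (Fin N) K)).map σ)⁻¹ * ((γ : Matrix (Fin N) (Fin N) K).map σ))ᵀ *
            ((weylLong N K : GL (Fin N) K) : Matrix (Fin N) (Fin N) K) := by
          rw [hw, Matrix.mul_one, Matrix.transpose_mul]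
    _ = ((weylLong N K : GL (Fin N) K) : Matrix (Fin N) (Fin N) K) := by
          rw [Matrix.nonsing_inv_mul _ hdet, Matrix.transpose_one, Matrix.one_mul]

omit [Valued K ℤᵐ⁰] in
/-- **`⟨γ y, Θ_σ(γ) x⟩_{J₀} = ⟨y, x⟩_{J₀}`**: the `J₀`-pairing is invariant under `(γ, Θ_σ γ)` acting on the two arguments, for every `γ ∈ GL_N(K)`
(★ `pairing_mulVec_left` ∕ ★ `pairing_mulVec_right` + the matrix identity above). [cite: Rogawski1990, §1.9 p. 8] [cite: Jacobowitz1962, §4] -/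
theorem pairing_mulVec_qsInvolution_mulVec (γ : GL (Fin N) K) (y x : Fin N → K) :
    pairing σ ((StdForm.antidiagonal N).over K) ((γ : Matrix (Fin N) (Fin N) K).mulVec y)
        (((UnitaryGroup.qsInvolution σ γ : GL (Fin N) K) : Matrix (Fin N) (Fin N) K).mulVec x) =
      pairing σ ((StdForm.antidiagonal N).over K) y x := by
  rw [pairing_mulVec_left, pairing_mulVec_right, transpose_map_mul_antidiagonal_mul_qsInvolution]

/-! ## W9-a: `(γ·M)^♯ = Θ_σ(γ)·M^♯` -/

/-- **W9-a (S) EQUIVARIANCE OF THE `J₀`-DUAL UNDER ALL OF `GL_N(K)`.**  `(γ·M)^♯ = Θ_σ(γ)·M^♯` for every `γ ∈ GL_N(K)` and every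
`𝒪`-submodule `M` (no hypothesis on `σ`): `ᵗ(σ(γy)) J₀ x = ᵗ(σy) J₀ (J₀⁻¹ ᵗ(σγ) J₀ x)` and `J₀⁻¹ = J₀ = w⁰`, so `x ∈ (γM)^♯ ⟺
(w⁰ ᵗ(σγ) w⁰) x ∈ M^♯ ⟺ x ∈ Θ_σ(γ)·M^♯` (★ `coe_qsInvolution`, ★ `antidiagonal_over_eq_coe_weylLong`, ★ `mem_dualLatt`, ★ `mem_mapGL_iff`).
The unitary case `Θ_σ u = u` is ★ `dualLatt_mapGL`. [cite: Rogawski1990, §1.9 p. 8] [cite: ShimuraIATAF1971, §3.1] -/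
theorem dualLatt_mapGL_eq_mapGL_qsInvolution (γ : GL (Fin N) K) (M : Submodule 𝒪[K] (Fin N → K)) :
    dualLatt σ ((StdForm.antidiagonal N).over K) (mapGL γ M) =
      mapGL (UnitaryGroup.qsInvolution σ γ) (dualLatt σ ((StdForm.antidiagonal N).over K) M) := by
  ext x
  rw [mem_dualLatt, mem_mapGL_iff, mem_dualLatt]
  -- `x = Θ(γ) · (Θ(γ)⁻¹ x)`
  have hx : ((UnitaryGroup.qsInvolution σ γ : GL (Fin N) K) : Matrix (Fin N) (Fin N) K).mulVec
      ((((UnitaryGroup.qsInvolution σ γ)⁻¹ : GL (Fin N) K) : Matrix (Fin N) (Fin N) K).mulVec x) = x := by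
    rw [Matrix.mulVec_mulVec, ← Units.val_mul, mul_inv_cancel, Units.val_one, Matrix.one_mulVec]
  constructor
  · intro h y hy
    have := h _ (Submodule.mem_map.2 ⟨y, hy, rfl⟩)
    rw [LinearMap.restrictScalars_apply, Matrix.toLin'_apply] at this
    rwa [← hx, pairing_mulVec_qsInvolution_mulVec] at this
  · intro h y hy
    obtain ⟨y', hy', rfl⟩ := Submodule.mem_map.1 hy
    rw [LinearMap.restrictScalars_apply, Matrix.toLin'_apply, ← hx, pairing_mulVec_qsInvolution_mulVec]
    exact h y' hy'

/-! ## W9-b: `Θ_σ(γ)·𝒪^N = (γ·𝒪^N)^♯` -/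

/-- **W9-b (S) `Θ_σ(γ)·𝒪^N = (γ·𝒪^N)^♯`.**  From W9-a at `M = 𝒪^N` and the `J₀`-self-duality of the standard lattice
(★ `dualLatt_stdLattice_eq_self σ hvσ` with ★ `isUnit_det_antidiagonal`, ★ `isIntMatrix_antidiagonal`, ★ `isIntMatrix_antidiagonal_inv`).
This is the lattice form of «`g K_E ↦ Θ(g) K_E` is `Λ ↦ Λ^♯` on `X_E = GL_N(E_w)/K_E`». [cite: Rogawski1990, §1.9–§1.10 pp. 8–9]
[cite: Jacobowitz1962, §4] -/
theorem mapGL_qsInvolution_stdLattice (hvσ : ∀ a, Valued.v (σ a) = Valued.v a) (γ : GL (Fin N) K) :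
    mapGL (UnitaryGroup.qsInvolution σ γ) (stdLattice K N) =
      dualLatt σ ((StdForm.antidiagonal N).over K) (mapGL γ (stdLattice K N)) := by
  rw [dualLatt_mapGL_eq_mapGL_qsInvolution,
    dualLatt_stdLattice_eq_self σ hvσ isUnit_det_antidiagonal isIntMatrix_antidiagonal isIntMatrix_antidiagonal_inv]

/-! ## W9-d: `P_δ ∘ P_δ` is translation by the norm `N δ = δ Θ_σ(δ)` -/

/-- **W9-d (S) `P_δ ∘ P_δ` = TRANSLATION BY THE NORM `N δ = δ·Θ_σ(δ)`** on full-rank lattices, for an involution `σ` preserving `v`: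
`δ·(δ·Λ^♯)^♯ = δ·Θ_σ(δ)·Λ^♯♯ = (δ Θ_σ δ)·Λ` (W9-a, then ★ `dualLatt_dualLatt_latt σ hσσ hvσ` for the hermitian unimodular `J₀`:
`(J₀.map σ)ᵀ = J₀`, ★ `isUnit_det_antidiagonal`; ★ `mapGL_mul`).  In particular `P_δ` is inclusion-reversing (★ `dualLatt_antitone`,
★ `mapGL_le_mapGL_iff`) with `P_δ² = ` the action of `N δ`, as the row states. [cite: Kottwitz1986BaseChangeUnits, §1 p. 242 (C′) `Nδ`]
[cite: ShimuraIATAF1971, §3.1] -/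
theorem mapGL_dualLatt_mapGL_dualLatt_latt (hσσ : ∀ a, σ (σ a) = a) (hvσ : ∀ a, Valued.v (σ a) = Valued.v a)
    (δ : GL (Fin N) K) {A : Matrix (Fin N) (Fin N) K} (hA : IsUnit A.det) :
    mapGL δ (dualLatt σ ((StdForm.antidiagonal N).over K) (mapGL δ (dualLatt σ ((StdForm.antidiagonal N).over K) (latt A)))) =
      mapGL (δ * UnitaryGroup.qsInvolution σ δ) (latt A) := by
  have hHh : (((StdForm.antidiagonal N).over K).map σ)ᵀ = (StdForm.antidiagonal N).over K := by
    rw [StdForm.over_map, StdForm.transpose_over]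
  rw [dualLatt_mapGL_eq_mapGL_qsInvolution, dualLatt_dualLatt_latt σ hσσ hvσ isUnit_det_antidiagonal hHh hA, mapGL_mul]

/-! ## W9-e₁: the twisted polar is the dual for the twisted form `H δ⁻¹` -/

/-- **W9-e₁ (XS) `P_δ Λ = Λ^{♯, H δ⁻¹}` — the twisted polar IS the dual for the twisted form `h_δ(x, y) = ᵗ(σx) H δ⁻¹ y`**, for every
form matrix `H`, every `δ` and every submodule (pure algebra: `x ∈ δ·M^{♯,H} ⟺ δ⁻¹x ∈ M^{♯,H} ⟺ ∀ y ∈ M, v (ᵗ(σy) H δ⁻¹ x) ≤ 1`;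
★ `mem_mapGL_iff`, ★ `mem_dualLatt`, `Matrix.mulVec_mulVec`).  Hence `Fix(P_δ) = {Λ : Λ^{♯, J₀δ⁻¹} = Λ}` literally.
[cite: ShimuraIATAF1971, §3.1] [cite: Jacobowitz1962, §4] -/
theorem mapGL_dualLatt_eq_dualLatt_mul_inv (δ : GL (Fin N) K) (H : Matrix (Fin N) (Fin N) K) (M : Submodule 𝒪[K] (Fin N → K)) :
    mapGL δ (dualLatt σ H M) = dualLatt σ (H * (((δ⁻¹ : GL (Fin N) K)) : Matrix (Fin N) (Fin N) K)) M := by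
  ext x
  rw [mem_mapGL_iff, mem_dualLatt, mem_dualLatt]
  simp only [pairing_mulVec_right]

end Summit.HodgeConjecture.HodgeConjecture.R90.S6

end
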